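import Summits.QuantumAdvantage.QuantumAdvantage.Theorems.OddPrimeWalkSignWalkFloor
import Summits.QuantumAdvantage.AdviceFreeQNC0.HiddenCoinsReduction

/-!
# OddPrimeWalk — the BOUNDED-JUNTA RUNG at `p = 5` (item stmt-QuantumAdvantage-24271 `BoundedJuntaRungFive`)

Cell qa-qnc0, route OddPrimeWalk (planner qa-qnc0-p2 g32, ROUND-32 §3bis / PROOF-BB: `BlindBitsAsymptotic`).  Prover qn-prover-3 g20.

THEOREM `oddPrimeWalk_boundedJuntaRungFive` (the route file's signature, verbatim): a u-walk strategy all of whose cuts read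
at most `q` fixed input bits (any positions, any tables, any charge) wins on at most `θ·2ⁿ` inputs, for every `θ > 2/3` and
`n ≥ n₀(q, θ)`.  Equivalently: the blind-bits constants `θ_k` (`1, 1, 7/8, 3/4, 23/32, 11/16, …`) tend to `2/3`.

PROOF = the tree's hidden-coins fibre reduction + the sign-walk floor:
* `hiddenCoinsReduction` (AdviceFreeQNC0/HiddenCoinsReduction, planner p2 g20 / prover g10): a bound `k` for the free-phase
  oblivious game `G_m` on `m` hidden coins (`FreePhase.Bound m k`) bounds every `(n − m)`-junta strategy by `(k/2^m)·2ⁿ`;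
* `freePhase_card_win_le`: in `G_m`, `(−1)^{WIN(x)} = Π_{j active} (2[V_j(x) = a_j] − 1)` with `V_j = |x| + |x_{<j}|` (mod 3)
  (`prod_sign_eq`, one optional phase per position), so `2·#WIN = 2^m − Σ_x Π_j(…) ≤ 2^m + (1/3 + ε)·2^m` by the SIGN-WALK FLOOR
  `oddPrimeWalk_signWalkFloorThree` (item 24332, `OddPrimeWalkSignWalkFloor`); i.e. `#WIN ≤ (2/3 + ε/2)·2^m` for `m ≥ m₀(ε)`.
Assembly: `m := m₀(2(θ − 2/3))`, `n₀ := q + m`, `k := ⌊θ·2^m⌋`.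
WHAT THIS IS NOT: the column-resolution rung (24278) / multi-counter rung (24257) need the mod-5 twist bounds on top; (R₁) untouched.
-/

namespace Summit.QuantumAdvantage.AdviceFreeQNC0.SignWalk

open Finset

/-- Active positions of a free-phase strategy. -/
def phA (m : ℕ) (φ : Fin (m + 1) → Option (ZMod 3)) : Finset (Fin (m + 1)) := univ.filter fun j => (φ j).isSome

/-- Targets of a free-phase strategy (arbitrary on inactive positions). -/
def phX (m : ℕ) (φ : Fin (m + 1) → Option (ZMod 3)) : Fin (m + 1) → ZMod 3 := fun j => (φ j).getD 0

/-- The walk value of the free-phase game in the sign-walk vocabulary: `V_j = z_j + z_m`. -/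
theorem V_eq (m : ℕ) (x : Fin m → Bool) (j : Fin (m + 1)) : FreePhase.V m x j = pre m x j.val + wtZ m x := by
  unfold FreePhase.V pre wtZ
  rw [add_comm]
  congr 3
  ext i
  simp only [mem_filter, mem_univ, true_and]
  exact And.comm

/-- The sign of one position: `−1` iff it is live. -/
theorem sign_live (m : ℕ) (φ : Fin (m + 1) → Option (ZMod 3)) (x : Fin m → Bool) (j : Fin (m + 1)) :
    (if FreePhase.live m φ x j = true then (-1 : ℝ) else 1)
      = if j ∈ phA m φ then (if pre m x j.val + wtZ m x = phX m φ j then 1 else -1) else 1 := by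
  rw [← V_eq]
  unfold FreePhase.live phA phX
  cases hφ : φ j with
  | none => simp [hφ]
  | some a =>
    simp only [hφ, mem_filter, mem_univ, true_and, Option.isSome_some, if_true, Option.getD_some, decide_eq_true_eq]
    by_cases h : FreePhase.V m x j = a <;> simp [h]

/-- `(−1)^{WIN(x)} = Π_{j active} (2[V_j = a_j] − 1)`, as the indicator identity `[WIN] = (1 − Π)/2`. -/
theorem win_indicator (m : ℕ) (φ : Fin (m + 1) → Option (ZMod 3)) (x : Fin m → Bool) :
    (if FreePhase.win m φ x = true then (1 : ℝ) else 0)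
      = (1 - ∏ j ∈ phA m φ, (if pre m x j.val + wtZ m x = phX m φ j then (1 : ℝ) else -1)) / 2 := by
  have hprod : ∏ j ∈ phA m φ, (if pre m x j.val + wtZ m x = phX m φ j then (1 : ℝ) else -1)
      = ∏ j : Fin (m + 1), (if FreePhase.live m φ x j = true then (-1 : ℝ) else 1) := by
    simp_rw [sign_live]
    rw [prod_ite_mem, univ_inter]
  rw [hprod, prod_ite, prod_const_one, mul_one, prod_const]
  unfold FreePhase.win
  set L := (univ.filter fun j : Fin (m + 1) => FreePhase.live m φ x j = true).card with hL
  rcases Nat.even_or_odd L with he | ho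
  · rw [he.neg_one_pow]
    have : ¬ (L % 2 = 1) := by rw [Nat.even_iff] at he; omega
    simp [this]
  · rw [ho.neg_one_pow]
    have : L % 2 = 1 := Nat.odd_iff.mp ho
    simp [this]

/-- **Free-phase game value → 2/3**: for every `ε > 0` and `m ≥ m₀(ε)`, every free-phase strategy on `m` hidden coins wins on at
most `(2/3 + ε)·2^m` coin patterns. -/
theorem freePhase_card_win_le (ε : ℝ) (hε : 0 < ε) : ∃ m₀ : ℕ, ∀ m ≥ m₀, ∀ φ : Fin (m + 1) → Option (ZMod 3),
    ((univ.filter fun x : Fin m → Bool => FreePhase.win m φ x = true).card : ℝ) ≤ (2 / 3 + ε) * (2 : ℝ) ^ m := by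
  obtain ⟨k₀, hk₀⟩ := Summit.QuantumAdvantage.QuantumAdvantage.Theorems.oddPrimeWalk_signWalkFloorThree (2 * ε) (by linarith)
  refine ⟨k₀, fun m hm φ => ?_⟩
  have hfloor := hk₀ m hm (phA m φ) (phX m φ)
  change -(1 / 3 + 2 * ε) * (2 : ℝ) ^ m ≤ ∑ x : Fin m → Bool, ∏ j ∈ phA m φ,
    (if pre m x j.val + wtZ m x = phX m φ j then (1 : ℝ) else -1) at hfloor
  have hcard : ((univ.filter fun x : Fin m → Bool => FreePhase.win m φ x = true).card : ℝ)
      = ∑ x : Fin m → Bool, (if FreePhase.win m φ x = true then (1 : ℝ) else 0) := by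
    rw [natCast_card_filter]
  rw [hcard]
  simp_rw [win_indicator]
  rw [← sum_div, sum_sub_distrib, sum_const, card_univ, Fintype.card_fun, Fintype.card_bool, Fintype.card_fin]
  simp only [nsmul_eq_mul, mul_one]
  push_cast
  linarith

/-- The natural-number form consumed by the hidden-coins reduction: `FreePhase.Bound m ⌊θ·2^m⌋` for `m ≥ m₀(θ)`. -/
theorem freePhase_bound (θ : ℝ) (hθ : 2 / 3 < θ) : ∃ m₀ : ℕ, ∀ m ≥ m₀, FreePhase.Bound m ⌊θ * (2 : ℝ) ^ m⌋₊ := by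
  obtain ⟨m₀, hm₀⟩ := freePhase_card_win_le (θ - 2 / 3) (by linarith)
  refine ⟨m₀, fun m hm φ => ?_⟩
  apply Nat.le_floor
  have h := hm₀ m hm φ
  have e : 2 / 3 + (θ - 2 / 3) = θ := by ring
  rw [e] at h
  exact h

end Summit.QuantumAdvantage.AdviceFreeQNC0.SignWalk

namespace Summit.QuantumAdvantage.QuantumAdvantage.Theorems

open Finset Summit.QuantumAdvantage.AdviceFreeQNC0 Summit.QuantumAdvantage.AdviceFreeQNC0.SignWalk

set_option linter.dupNamespace false in
/-- **BOUNDED-JUNTA RUNG at `p = 5`** (item stmt-QuantumAdvantage-24271 `BoundedJuntaRungFive`, route OddPrimeWalk, the route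
file's signature verbatim): a strategy all of whose cuts depend on at most `q` fixed input bits wins the u-walk game on at most
`θ·2ⁿ` inputs for every `θ > 2/3`, `n ≥ n₀(q, θ)`. -/
theorem oddPrimeWalk_boundedJuntaRungFive :
    ∀ q : ℕ, ∀ θ : ℝ, 2 / 3 < θ → ∃ n₀ : ℕ, ∀ n ≥ n₀, ∀ c : ℕ, ∀ Q : Finset (Fin n), Q.card ≤ q → ∀ y : Fin (n + 1) → (Fin n → Bool) → Bool, (∀ g u u', (∀ i ∈ Q, u i = u' i) → y g u = y g u') → ((Finset.univ.filter fun u : Fin n → Bool => Summit.QuantumAdvantage.AdviceFreeQNC0.ringWinU c y u = true).card : ℝ) ≤ θ * (2 : ℝ) ^ n := by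
  intro q θ hθ
  obtain ⟨m₀, hm₀⟩ := freePhase_bound θ hθ
  refine ⟨q + m₀, fun n hn c Q hQ y hy => ?_⟩
  have hred := hiddenCoinsReduction m₀ _ (hm₀ m₀ le_rfl) n c Q (by omega) y hy
  refine hred.trans (mul_le_mul_of_nonneg_right ?_ (by positivity))
  rw [div_le_iff₀ (by positivity)]
  exact Nat.floor_le (by positivity)

end Summit.QuantumAdvantage.QuantumAdvantage.Theorems
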